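import Mathlib
import HarnessLib
import Summits.HubbardSuperconductivity.HubbardSuperconductivity.Theorems.KLProgrammeKLRegimeEngineV8IsoTupleExportW
import Summits.HubbardSuperconductivity.HubbardSuperconductivity.Theorems.KLProgrammeKLRegimeEngineV8TowerExports2
import Summits.HubbardSuperconductivity.HubbardSuperconductivity.Theorems.KLProgrammeKLRegimeKernelNormsLevelsDefs

/-!
# Route `KLProgramme` — ENGINE child gen 8 (stmt-HubbardSuperconductivity-20437 `KLRegimeEngineV17F2`), SKELETON v2 class #6, the «E5F-∀B» SUCCESSOR TEXT
# of `…EngineV8IsoTupleExportW` (plan g20 (R81) question (Q-X2-VALUE), owner's answer (B)/(B1), KL STATUS 2026-08-28 ≈00:20Z;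
# cell gate-hubbard-kl, seat hubbard-kl-k3c2-p2 g13 = class-#6 text owner, route (M) M1/M3 owner)

NAME MAP (W ↦ B): `IsoTupleLineAt a b ↦ IsoTupleLineBAt A c c′` · `IsIsoPkgW ↦ IsIsoPkgB` · `IsoTupleLineStepW ↦ IsoTupleLineStepB` (+ table parameter `CU`) ·
`klIsoPkgW ↦ klIsoPkgB` · `klE5aW/klE5bW/klE5uW ↦ klE5AB/klE5cB/klE5dB/klE5uB`.  Nothing landed is edited; the W module stays importable.

WHY (located finding «(M)-VALUE-INPUT» = sharp «(c)-E5-FIT», (R81)).  Route (M) proves, for the iso-sectorised scale-`n` quartic kernel `𝒱ₙ[Kₙ]` at every resolution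
`m ≥ n`, `fixedTupleL1 ≤ 2⁹·Bₙ + 2¹⁷·Xₙ` (`…EngineIsoLineNumeral` p585788) with `Bₙ` = the sup over the bare ball of the `↑↓` Cooper value `‖λₙ[Kₙ](k₁,k₂,k₃)‖` and
`Xₙ` = the Λ_m-weighted first moments of the standard iso tuples (M2).  The W text's conclusion `IsoTupleLineAt a b … n` (`≤ a·U + b·(Klam U)²`) is U-LINEAR WITHOUT
`B`, so closing `IsoTupleLineStepW` needs a scale-`n` VALUE datum in U-vanishing currency — and its binders carry none (history = value data at `j < n`; the (W-a)
weighted norms at `j = n` are `ε`-currency × `2ⁿ`; the missing datum is stub (c)ₙ's own increment).  The successor below states the iso line in (E5-F)ₙ's OWN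
`∀ B` shape with three free constants, so that
* the PRODUCER (route (M)) closes the step from M2 ALONE, with NO value datum (`…ExportBClosers`: `(A, c, c′) = (2⁹, 2¹⁷c_M, 2¹⁷c_M′)`), and
* the CONSUMER (stub (c)'s (E5-F)ₙ) absorbs `c·U + c′·(Klam U)²` into `CF·B` through the value lane's lower bound `‖λₙ[Kₙ](q,q,q₃)‖ ≥ U/2` — the SAME
  residual inputs as today's W door (`isoTupleL1AtV17F_of_isoTupleLineAt_hist`): history, (E2″-F)ₙ, two bare-ball points, `Gfr₀|U| ≤ E0/32`, rows `≤ U/2`.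

CONTENTS.
* §1 **`IsoTupleLineBAt L M A c c′ P β U μ n`** (+ `.mono`, `IsoTupleLineAt.toB` (a W line `(a,b)` is the B line `(0,a,b)`), `isoTupleLineBAt_of_isoTupleL1AtV17F`
  ((E5-F)ₙ is the B line `(CF,0,CF)`), `IsoTupleLineBAt.toLine_of_valueLine` (B line + a value line `≤ c_B·U` ⇒ W line `(A·c_B + c, c′)` — e.g. with split's
  `QuarticValueLineV17F … n` once it is in the history));
* §2 the consumer door: **`isoTupleL1AtV17F_of_isoTupleLineBAt_of_lowValue`** (θ-generic B-absorption), **`lowValue_half_of_flowValues` / `lowValue_half_of_hist`**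
  (the value lane's `U/2 ≤ ‖λₙ[Kₙ](q,q,q₃)‖` BY NAME, from `…EngineIsoTupleV17FDoor` §2–§3), **`isoTupleL1AtV17F_of_isoTupleLineBAt_hist`** (the stub-(c) closer's door);
* §3 **`IsIsoPkgB P CF (A, c, c′, u)`** — fit `A + 2·(c + c′·Klam²·u cc) ≤ CF`; `IsIsoPkgW.toB`;
* §4 **`IsoTupleLineStepB P R Q CU A c c′ u`** — `IsoTupleLineStepW`'s binders VERBATIM plus the PUBLIC scale-`n` data of stub (b)ₙ an M2 supplier may read
  (`KernelNormsV4 … (Kₙ) n`, stub (c)'s levels bundle `∀ j ≤ n, KernelNormsLevels … j ∧ KernelNormsWt4 … j` VERBATIM, the class-#1 merged exports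
  `∀ j ≤ n, LevelsUExportMixedAt L M CU P β U μ j` at a table PARAMETER `CU` (:= `klCU2 P R (klEngQ7 P R)` at composition), `EngineFirstMoments L M G P Q β U μ (Kₙ) n`)
  and `hiso : ∀ j < n, IsoTupleLineBAt …`; conclusion `IsoTupleLineBAt L M A c c′ P β U μ n`;
* §5 the deferred package **`klIsoPkgB P R Q CU CF`**, projections **`klE5AB / klE5cB / klE5dB / klE5uB`**, rows (`isIsoPkgB_klIsoPkgB`, `_nonneg ×3`, `klE5uB_pos`,
  `klE5B_fit`, `klE5B_fit_of_le`), `isoTupleLineStepB_klE5B_of_exists / _of`.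
RENDER DELTA for the registrant: (X).2 condition ↦ `∃ e, IsIsoPkgB P <G>.CF e ∧ IsoTupleLineStepB P R (QT P R) (klCU2 P R (klEngQ7 P R)) e.1 e.2.1 e.2.2.1 e.2.2.2`;
(c)'s `hiso` binder ↦ `∀ j ≤ n, IsoTupleLineBAt L M (klE5AB …) (klE5cB …) (klE5dB …) P β U μ j`; DefsU11 row `klE5uW ↦ klE5uB`; §C glue ↦ `…ExportBClosers`.

Definitions with bodies + bookkeeping + the consumer door (proved); nothing about the model is asserted; nothing asserts superconductivity.
-/

noncomputable section

namespace Summit.HubbardSuperconductivity.HubbardSuperconductivity.Theorems.KLRegimeSplit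

set_option linter.dupNamespace false -- summit = problem name (single-conjunct summit), D-0017

open Real Finset Literature.MathematicalPhysics.QuantumLattice Literature.Probability.LatticeModels
open Summit.HubbardSuperconductivity.HubbardSuperconductivity.Theorems.KLProgrammeLegKernels
open Summit.HubbardSuperconductivity.HubbardSuperconductivity.Theorems.DispersionFlow
open Summit.HubbardSuperconductivity.HubbardSuperconductivity.Theorems.EngineV8


/-! ## §1 The ∀B iso fixed-tuple line (class #6 successor text) -/

section Model

variable (L M : ℕ) [NeZero L] [NeZero M]

/-- **`IsoTupleLineBAt L M A c c′ P β U μ n`** — class #6 «E5F-∀B»: for every `B ≥ 0` bounding the `↑↓` Cooper values `λₙ[Kₙ](k₁,k₂,k₃)` on the BARE ball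
`klBall L μ 0`, every isotropic re-sectorisation `m ≥ n` of the scale-`n` one-shot quartic kernel `𝒱ₙ[Kₙ]`, every admissible iso 4-tuple `Ω` and every pinned
point, `fixedTupleL1 β 3 (klIsoKernelAt … (Kₙ) n m) Ω x₁ ≤ A·B + c·U + c′·(Klam U)²`.  (E5-F)ₙ `IsoTupleL1AtV17F` is the instance `(A, c, c′) = (G.CF, 0, G.CF)`;
the W text `IsoTupleLineAt a b` is the instance `(0, a, b)`. -/
def IsoTupleLineBAt (A c c' : ℝ) (P : SplitConsts) (β U μ : ℝ) (n : ℕ) : Prop :=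
  ∀ B : ℝ, 0 ≤ B →
    (∀ k₁ ∈ klBall L μ 0, ∀ k₂ ∈ klBall L μ 0, ∀ k₃ ∈ klBall L μ 0,
        ‖klQuarticValue L M β U μ (klFlowFrameU L M β U μ n) n 0 1 k₁ k₂ k₃‖ ≤ B) →
      ∀ m : ℕ, n ≤ m → ∀ Ω ∈ bgmSectorSet L M (klIsoFamily L M β μ (klFlowFrameU L M β U μ n) klE0 m) 4, ∀ x₁ : SpaceTimeIdx L M,
        fixedTupleL1 L M β 3 (klIsoKernelAt L M β U μ (klFlowFrameU L M β U μ n) n m) Ω x₁ ≤ A * B + c * U + c' * (P.Klam * U) ^ 2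

variable {L M}

/-- Larger constants are still met (`0 ≤ U`). -/
theorem IsoTupleLineBAt.mono {A A' c c₁ c' c₁' : ℝ} {P : SplitConsts} {β U μ : ℝ} {n : ℕ} (h : IsoTupleLineBAt L M A c c' P β U μ n) (hU : 0 ≤ U)
    (hA : A ≤ A') (hc : c ≤ c₁) (hc' : c' ≤ c₁') : IsoTupleLineBAt L M A' c₁ c₁' P β U μ n := by
  intro B hB hvals m hm Ω hΩ x₁
  refine (h B hB hvals m hm Ω hΩ x₁).trans ?_
  have h1 : A * B ≤ A' * B := mul_le_mul_of_nonneg_right hA hB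
  have h2 : c * U ≤ c₁ * U := mul_le_mul_of_nonneg_right hc hU
  have h3 : c' * (P.Klam * U) ^ 2 ≤ c₁' * (P.Klam * U) ^ 2 := mul_le_mul_of_nonneg_right hc' (sq_nonneg _)
  linarith

/-- **A W line is a B line**: `IsoTupleLineAt L M a b … n → IsoTupleLineBAt L M 0 a b … n` (the value hypothesis is not used). -/
theorem IsoTupleLineAt.toB {a b : ℝ} {P : SplitConsts} {β U μ : ℝ} {n : ℕ} (h : IsoTupleLineAt L M a b P β U μ n) :
    IsoTupleLineBAt L M 0 a b P β U μ n := by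
  intro B _ _ m hm Ω hΩ x₁
  simpa only [zero_mul, zero_add] using h m hm Ω hΩ x₁

/-- **(E5-F)ₙ is a B line**: `IsoTupleL1AtV17F L M G P … n → IsoTupleLineBAt L M G.CF 0 G.CF P … n`. -/
theorem isoTupleLineBAt_of_isoTupleL1AtV17F {G : GeoConsts} {P : SplitConsts} {β U μ : ℝ} {n : ℕ} (h : IsoTupleL1AtV17F L M G P β U μ n) :
    IsoTupleLineBAt L M G.CF 0 G.CF P β U μ n := by
  intro B hB hvals m hm Ω hΩ x₁
  simpa only [zero_mul, add_zero] using h B hB hvals m hm Ω hΩ x₁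

/-- **B line + value line ⇒ W line**: if the `↑↓` Cooper values on the bare ball are `≤ c_B·U` (`0 ≤ c_B·U`), a B line `(A, c, c′)` gives the W line
`(A·c_B + c, c′)` — e.g. with split's `QuarticValueLineV17F … n` (`c_B = Klam`, `U ≥ 0`) once that clause is in the history. -/
theorem IsoTupleLineBAt.toLine_of_valueLine {A c c' cB : ℝ} {P : SplitConsts} {β U μ : ℝ} {n : ℕ} (h : IsoTupleLineBAt L M A c c' P β U μ n)
    (hcB : 0 ≤ cB * U)
    (hval : ∀ k₁ ∈ klBall L μ 0, ∀ k₂ ∈ klBall L μ 0, ∀ k₃ ∈ klBall L μ 0,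
      ‖klQuarticValue L M β U μ (klFlowFrameU L M β U μ n) n 0 1 k₁ k₂ k₃‖ ≤ cB * U) :
    IsoTupleLineAt L M (A * cB + c) c' P β U μ n := by
  intro m hm Ω hΩ x₁
  have h1 := h (cB * U) hcB hval m hm Ω hΩ x₁
  refine h1.trans (le_of_eq ?_)
  ring

/-- **B line + split's value line at `n`** (`QuarticValueLineV17F … n`, `0 ≤ U`) ⇒ the W line `(A·Klam + c, c′)`. -/
theorem IsoTupleLineBAt.toLine_of_quarticValueLineV17F {A c c' : ℝ} {P : SplitConsts} {β U μ : ℝ} {n : ℕ} (h : IsoTupleLineBAt L M A c c' P β U μ n)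
    (hK : 0 ≤ P.Klam) (hU : 0 ≤ U) (hval : QuarticValueLineV17F L M P β U μ n) :
    IsoTupleLineAt L M (A * P.Klam + c) c' P β U μ n := by
  have hval' : ∀ k₁ ∈ klBall L μ 0, ∀ k₂ ∈ klBall L μ 0, ∀ k₃ ∈ klBall L μ 0,
      ‖klQuarticValue L M β U μ (klFlowFrameU L M β U μ n) n 0 1 k₁ k₂ k₃‖ ≤ P.Klam * U := by
    intro k₁ hk₁ k₂ hk₂ k₃ hk₃
    simpa only [abs_of_nonneg hU] using hval k₁ hk₁ k₂ hk₂ k₃ hk₃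
  exact h.toLine_of_valueLine (mul_nonneg hK hU) hval'

/-! ## §2 The consumer door: (E5-F)ₙ from a B line by B-absorption through ONE value lower bound -/

/-- **(E5-F)ₙ from a B line and one value lower bound** (θ-generic).  If `IsoTupleLineBAt L M A c c′ … n`, if `θ·U ≤ ‖λₙ[Kₙ](k₁,k₂,k₃)‖` at some bare-ball triple
(`θ > 0`), and if `θ·A + (c + c′·Klam²·U) ≤ θ·CF` (`A, c, c′ ≥ 0`), then `IsoTupleL1AtV17F L M G P … n`: every admissible `B` is `≥ θ·U`, so
`c·U + c′·(Klam U)² ≤ (CF − A)·B`. -/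
theorem isoTupleL1AtV17F_of_isoTupleLineBAt_of_lowValue {G : GeoConsts} {P : SplitConsts} {β U μ : ℝ} {n : ℕ} (hU : 0 < U) (hCF : 0 ≤ G.CF)
    {A c c' θ : ℝ} (hc : 0 ≤ c) (hc' : 0 ≤ c') (hθ : 0 < θ) (hline : IsoTupleLineBAt L M A c c' P β U μ n)
    {k₁ k₂ k₃ : TorusSite 2 L} (hk₁ : k₁ ∈ klBall L μ 0) (hk₂ : k₂ ∈ klBall L μ 0) (hk₃ : k₃ ∈ klBall L μ 0)
    (hlow : θ * U ≤ ‖klQuarticValue L M β U μ (klFlowFrameU L M β U μ n) n 0 1 k₁ k₂ k₃‖)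
    (hfit : θ * A + (c + c' * P.Klam ^ 2 * U) ≤ θ * G.CF) :
    IsoTupleL1AtV17F L M G P β U μ n := by
  intro B hB hvals m hm Ω hΩ x₁
  have hθB : θ * U ≤ B := hlow.trans (hvals k₁ hk₁ k₂ hk₂ k₃ hk₃)
  have h1 := hline B hB hvals m hm Ω hΩ x₁
  have hsq : 0 ≤ (P.Klam * U) ^ 2 := sq_nonneg _
  have hK2U : 0 ≤ c + c' * P.Klam ^ 2 * U := by positivity
  -- `A ≤ CF`
  have hACF : θ * A ≤ θ * G.CF := by linarith
  have hA_le : A ≤ G.CF := le_of_mul_le_mul_left hACF hθ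
  -- the linear + quadratic part is `≤ (CF − A)·B`
  have h2 : (c + c' * P.Klam ^ 2 * U) * (θ * U) ≤ θ * (G.CF - A) * (θ * U) := by
    have : c + c' * P.Klam ^ 2 * U ≤ θ * (G.CF - A) := by linarith
    exact mul_le_mul_of_nonneg_right this (by positivity)
  have h3 : θ * (G.CF - A) * (θ * U) ≤ θ * (G.CF - A) * B :=
    mul_le_mul_of_nonneg_left hθB (mul_nonneg hθ.le (sub_nonneg.2 hA_le))
  have h4 : θ * ((c + c' * P.Klam ^ 2 * U) * U) ≤ θ * ((G.CF - A) * B) := by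
    have := h2.trans h3
    nlinarith
  have h5 : (c + c' * P.Klam ^ 2 * U) * U ≤ (G.CF - A) * B := le_of_mul_le_mul_left h4 hθ
  have h6 : c * U + c' * (P.Klam * U) ^ 2 = (c + c' * P.Klam ^ 2 * U) * U := by ring
  have h7 : 0 ≤ G.CF * (P.Klam * U) ^ 2 := mul_nonneg hCF hsq
  calc fixedTupleL1 L M β 3 (klIsoKernelAt L M β U μ (klFlowFrameU L M β U μ n) n m) Ω x₁ ≤ A * B + c * U + c' * (P.Klam * U) ^ 2 := h1
    _ = A * B + (c + c' * P.Klam ^ 2 * U) * U := by rw [add_assoc, h6]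
    _ ≤ A * B + (G.CF - A) * B := by linarith
    _ = G.CF * B := by ring
    _ ≤ G.CF * B + G.CF * (P.Klam * U) ^ 2 := le_add_of_nonneg_right h7

/-- **The value lane's lower bound BY NAME (flow-data form)**: from the (E2-F2)₀ uv clause `h0`, the cross-frame increments `PairValueIncrementAtV17F … j`
(`1 ≤ j ≤ n`), two bare-ball points `q, q₃` with `4⁻¹ < |q + q₃|_𝕋`, the frame-rate law below `n` and the accumulated-rows smallness (`≤ U/2`):
`U/2 ≤ ‖λₙ[Kₙ](q, q, q₃)‖` (`n ≤ n_β + 1`). -/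
theorem lowValue_half_of_flowValues {G : GeoConsts} {P : SplitConsts} {Q : EngConsts} {β U μ : ℝ} (hG : G.WF) (hP : P.WF) (hQ : Q.WF) (hU : 0 < U)
    {n : ℕ} (hn : n ≤ nScales β + 1)
    (h0 : ∀ Qm : TorusSite 2 L, ∀ k ∈ klBall L μ 0, ∀ k' ∈ klBall L μ 0,
      ‖klPairAmplitude L M β U μ (klFlowFrameU L M β U μ 0) 0 Qm k k' - (U : ℂ)‖ ≤ initDevBar G U + legDressBarQ2 G P Q U 0 4)
    (hincr : ∀ j : ℕ, 1 ≤ j → j ≤ n → PairValueIncrementAtV17F L M G P Q β U μ j)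
    {q q₃ : TorusSite 2 L} (hq : q ∈ klBall L μ 0) (hqq : 4⁻¹ < klTorusNorm L (q + q₃))
    {κ : ℝ} (hκ0 : 0 ≤ κ) (hκ : κ ≤ 1 / 32)
    (hrate : ∀ j < n, frameDist (klFlowFrameU L M β U μ (j + 1)) (klFlowFrameU L M β U μ j) ≤ κ * klScale klE0 j)
    (hsmall : initDevBar G U + legDressBarQ2 G P Q U 0 4 +
        (3 * G.CF * (P.Klam * U) ^ 2 +
          ((G.cloc * P.Klam ^ 2 * (1 - (4 : ℝ) ^ (-G.θ))⁻¹ + 2 * Q.CR * P.Klam ^ 3 * |U|) * U ^ 2 + ∑ j ∈ range n, Q.CL β j / L) +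
            7 / 3 * (G.CF * (P.Klam * U) ^ 2) + 20 * (Q.CR * ((P.Klam * U) ^ 2 + (P.Klam * |U|) ^ 3)) +
              4 / 3 * (Q.CR * (P.Klam * U) ^ 2)) ≤ U / 2) :
    1 / 2 * U ≤ ‖klQuarticValue L M β U μ (klFlowFrameU L M β U μ n) n 0 1 q q q₃‖ := by
  have hrows := sum_pairValueRow_le (M := M) (μ := μ) hG hP hQ hn (q + q₃) q q hqq hκ0 hκ hrate
  have hge := norm_pairAmplitude_flow_ge_of_increments (G := G) (P := P) (Q := Q) hU.le n h0 hincr (q + q₃) hq hq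
  rw [klka_quarticValue_eq_pairAmplitude]
  linarith

/-- **The value lane's lower bound BY NAME (history form)** (`1 ≤ n ≤ n_β + 1`): the uv clause is (E2-F2)₀'s first conjunct at `j = 0 < n`, the increments
`1 ≤ j < n` are the history's (E2″-F)ⱼ, the increment at `j = n` is the CURRENT (E2″-F)ₙ, the frame-rate law comes from the history's (I-F jets) and
`R.Gfr 0·|U| ≤ klE0/32`: `U/2 ≤ ‖λₙ[Kₙ](q, q, q₃)‖`. -/
theorem lowValue_half_of_hist {G : GeoConsts} {P : SplitConsts} {Q : EngConsts} {R : RenConsts} {β U μ : ℝ} (hG : G.WF) (hP : P.WF) (hQ : Q.WF)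
    (hR : R.WF) (hU : 0 < U) {n : ℕ} (hn1 : 1 ≤ n) (hn : n ≤ nScales β + 1)
    (hhist : HistP klPredsV17F2 L M G P Q R β U μ 0 n) (hE2'' : PairValueIncrementAtV17F L M G P Q β U μ n)
    {q q₃ : TorusSite 2 L} (hq : q ∈ klBall L μ 0) (hqq : 4⁻¹ < klTorusNorm L (q + q₃))
    (hUκ : R.Gfr 0 * |U| ≤ 1 / 32 * klE0)
    (hsmall : initDevBar G U + legDressBarQ2 G P Q U 0 4 +
        (3 * G.CF * (P.Klam * U) ^ 2 +
          ((G.cloc * P.Klam ^ 2 * (1 - (4 : ℝ) ^ (-G.θ))⁻¹ + 2 * Q.CR * P.Klam ^ 3 * |U|) * U ^ 2 + ∑ j ∈ range n, Q.CL β j / L) +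
            7 / 3 * (G.CF * (P.Klam * U) ^ 2) + 20 * (Q.CR * ((P.Klam * U) ^ 2 + (P.Klam * |U|) ^ 3)) +
              4 / 3 * (Q.CR * (P.Klam * U) ^ 2)) ≤ U / 2) :
    1 / 2 * U ≤ ‖klQuarticValue L M β U μ (klFlowFrameU L M β U μ n) n 0 1 q q q₃‖ := by
  have hh := (histP_klPredsV17F2_iff L M G P Q R β U μ 0 n).1 hhist
  have h0 : ∀ Qm : TorusSite 2 L, ∀ k ∈ klBall L μ 0, ∀ k' ∈ klBall L μ 0,
      ‖klPairAmplitude L M β U μ (klFlowFrameU L M β U μ 0) 0 Qm k k' - (U : ℂ)‖ ≤ initDevBar G U + legDressBarQ2 G P Q U 0 4 :=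
    ((hh 0 (by omega)).2.2.1).2.2.1.1 rfl
  have hincr : ∀ j : ℕ, 1 ≤ j → j ≤ n → PairValueIncrementAtV17F L M G P Q β U μ j := by
    intro j hj1 hjn
    rcases Nat.lt_or_eq_of_le hjn with hlt | rfl
    · exact ((hh j hlt).2.2.1).2.2.2.1
    · exact hE2''
  have hrate : ∀ j < n, frameDist (klFlowFrameU L M β U μ (j + 1)) (klFlowFrameU L M β U μ j) ≤ 1 / 32 * klScale klE0 j :=
    fun j hj => frameDist_klFlowFrameU_succ_le_rate (fun m hm => ((hh m (by omega)).2.1).2.1) (hR.2.2 0) hUκ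
  exact lowValue_half_of_flowValues hG hP hQ hU hn h0 hincr hq hqq (by norm_num) le_rfl hrate hsmall

/-- **THE STUB-(c) DOOR in B-form** (`1 ≤ n ≤ n_β + 1`): `IsoTupleLineBAt L M A c c′ … n` + the stub's history + the CURRENT (E2″-F)ₙ + two bare-ball points with
`4⁻¹ < |q + q₃|_𝕋` + `R.Gfr 0·|U| ≤ klE0/32` + the accumulated-rows smallness + the fit `A + 2·(c + c′·Klam²·U) ≤ CF` (`A, c, c′ ≥ 0`) ⟹ `IsoTupleL1AtV17F … n`.
Residual inputs IDENTICAL to the W door `isoTupleL1AtV17F_of_isoTupleLineAt_hist`; the fit is `klE5B_fit_of_le` below the deferred threshold. -/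
theorem isoTupleL1AtV17F_of_isoTupleLineBAt_hist {G : GeoConsts} {P : SplitConsts} {Q : EngConsts} {R : RenConsts} {β U μ : ℝ}
    (hG : G.WF) (hP : P.WF) (hQ : Q.WF) (hR : R.WF) (hU : 0 < U) {n : ℕ} (hn1 : 1 ≤ n) (hn : n ≤ nScales β + 1) {A c c' : ℝ}
    (hc : 0 ≤ c) (hc' : 0 ≤ c') (hline : IsoTupleLineBAt L M A c c' P β U μ n) (hfit : A + 2 * (c + c' * P.Klam ^ 2 * U) ≤ G.CF)
    (hhist : HistP klPredsV17F2 L M G P Q R β U μ 0 n) (hE2'' : PairValueIncrementAtV17F L M G P Q β U μ n)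
    {q q₃ : TorusSite 2 L} (hq : q ∈ klBall L μ 0) (hq₃ : q₃ ∈ klBall L μ 0) (hqq : 4⁻¹ < klTorusNorm L (q + q₃))
    (hUκ : R.Gfr 0 * |U| ≤ 1 / 32 * klE0)
    (hsmall : initDevBar G U + legDressBarQ2 G P Q U 0 4 +
        (3 * G.CF * (P.Klam * U) ^ 2 +
          ((G.cloc * P.Klam ^ 2 * (1 - (4 : ℝ) ^ (-G.θ))⁻¹ + 2 * Q.CR * P.Klam ^ 3 * |U|) * U ^ 2 + ∑ j ∈ range n, Q.CL β j / L) +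
            7 / 3 * (G.CF * (P.Klam * U) ^ 2) + 20 * (Q.CR * ((P.Klam * U) ^ 2 + (P.Klam * |U|) ^ 3)) +
              4 / 3 * (Q.CR * (P.Klam * U) ^ 2)) ≤ U / 2) :
    IsoTupleL1AtV17F L M G P β U μ n := by
  have hCF : 0 ≤ G.CF := hG.2.2.2.2.2.2.2.2.2.2.2.2.2.1
  have hlow := lowValue_half_of_hist (M := M) hG hP hQ hR hU hn1 hn hhist hE2'' hq hqq hUκ hsmall
  refine isoTupleL1AtV17F_of_isoTupleLineBAt_of_lowValue hU hCF hc hc' (by norm_num : (0 : ℝ) < 1 / 2) hline hq hq hq₃ hlow ?_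
  linarith

end Model

/-! ## §3 Admissible packages (fit against a CF parameter) -/

/-- **`IsIsoPkgB P CF (A, c, c′, u)`**: `0 ≤ A`, `0 ≤ c`, `0 ≤ c′`, and for every regime constant `cc` the threshold `u cc` is positive and FITS the door:
`A + 2·(c + c′·Klam²·(u cc)) ≤ CF`. -/
def IsIsoPkgB (P : SplitConsts) (CF : ℝ) (e : ℝ × ℝ × ℝ × (ℝ → ℝ)) : Prop :=
  0 ≤ e.1 ∧ 0 ≤ e.2.1 ∧ 0 ≤ e.2.2.1 ∧ ∀ cc : ℝ, 0 < e.2.2.2 cc ∧ e.1 + 2 * (e.2.1 + e.2.2.1 * P.Klam ^ 2 * e.2.2.2 cc) ≤ CF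

/-- The trivial package `(0, 0, 0, 1)` is admissible for every `CF ≥ 0`. -/
theorem isIsoPkgB_zero (P : SplitConsts) {CF : ℝ} (hCF : 0 ≤ CF) : IsIsoPkgB P CF (0, 0, 0, fun _ => 1) := by
  refine ⟨le_rfl, le_rfl, le_rfl, fun cc => ⟨one_pos, ?_⟩⟩
  simp only [zero_mul, mul_one, add_zero, mul_zero]
  exact hCF

/-- **A W package is a B package**: `IsIsoPkgW P CF (a, b, u) → IsIsoPkgB P CF (0, a, b, u)` (`2·(CF/2) = CF`). -/
theorem IsIsoPkgW.toB {P : SplitConsts} {CF : ℝ} {a b : ℝ} {u : ℝ → ℝ} (h : IsIsoPkgW P CF (a, b, u)) : IsIsoPkgB P CF (0, a, b, u) := by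
  refine ⟨le_rfl, h.1, h.2.1, fun cc => ⟨(h.2.2 cc).1, ?_⟩⟩
  have := (h.2.2 cc).2
  simp only at this ⊢
  linarith

/-! ## §4 The successor step (parameter-Q, table parameter CU, public scale-`n` data of stub (b)ₙ) -/

/-- **`IsoTupleLineStepB P R Q CU A c c′ u`** — class #6 «E5F-∀B» step: for every geometry package `G` (`G.WF`), at the TABLE package `Q` (parameter-Q) and the
class-#1 table `CU` (parameter), under the v2 stub binders (`klEngC₃6`, `klEngU₀10`, the step's own threshold `u cc`, `klEngL₄ P R`, `klEngM₃`; `n ≤ nScales β + 1`,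
`IsKLRegime`), the history at `G P Q R`, the admissibility of `Kₙ`, the PUBLIC scale-`n` data of stub (b)ₙ (`KernelNormsV4` at `Kₙ`; the levels bundle
`KernelNormsLevels ∧ KernelNormsWt4` at every `j ≤ n` at frame `Kₙ` — stub (c)'s binder verbatim; `EngineFirstMoments` at `Kₙ`), the class-#1 merged exports at
every `j ≤ n`, and the B lines at every `j < n` give the B line at `n`. -/
def IsoTupleLineStepB (P : SplitConsts) (R : RenConsts) (Q : EngConsts) (CU : ℕ → ℝ) (A c c' : ℝ) (u : ℝ → ℝ) : Prop :=
  ∀ G : GeoConsts, G.WF →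
    ∀ cc : ℝ, 0 < cc → cc ≤ klEngC₃6 P R →
      ∀ μ ∈ klWindowC, ∀ U : ℝ, 0 < U → U ≤ klEngU₀10 P R cc → U ≤ u cc →
        ∀ β : ℝ, klBetaMin ≤ β → β ≤ Real.exp (cc / U ^ 2) →
          ∀ (L M : ℕ) [NeZero L] [NeZero M], klEngL₄ P R β U ≤ L → klEngM₃ β U L ≤ M →
            ∀ n : ℕ, n ≤ nScales β + 1 → IsKLRegime U cc (-(n : ℤ)) →
              HistP klPredsV17F2 L M G P Q R β U μ 0 n →
                FrameOK R U (nScales β) μ (klFlowFrameU L M β U μ n) →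
                  KernelNormsV4 L M P Q β U μ (klFlowFrameU L M β U μ n) n →
                    (∀ j ≤ n, (KernelNormsLevels L M P Q β U μ (klFlowFrameU L M β U μ n) j ∧
                      KernelNormsWt4 L M (klWtBudget P Q U j) β U μ (klFlowFrameU L M β U μ n) j)) →
                      (∀ j ≤ n, LevelsUExportMixedAt L M CU P β U μ j) →
                        EngineFirstMoments L M G P Q β U μ (klFlowFrameU L M β U μ n) n →
                          (∀ j < n, IsoTupleLineBAt L M A c c' P β U μ j) →
                            IsoTupleLineBAt L M A c c' P β U μ n

/-! ## §5 The successor deferred package (5 keys + the CF parameter) -/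

section Deferred

variable (P : SplitConsts) (R : RenConsts) (Q : EngConsts) (CU : ℕ → ℝ) (CF : ℝ)

/-- The deferred class-#6 B package: SOME admissible `(A, c, c′, u)` for which the step holds, else `(0, 0, 0, 1)`. -/
def klIsoPkgB : ℝ × ℝ × ℝ × (ℝ → ℝ) :=
  open scoped Classical in
  if h : ∃ e : ℝ × ℝ × ℝ × (ℝ → ℝ), IsIsoPkgB P CF e ∧ IsoTupleLineStepB P R Q CU e.1 e.2.1 e.2.2.1 e.2.2.2 then Classical.choose h
  else (0, 0, 0, fun _ => 1)

/-- **`klE5AB`** — the deferred B-coefficient `A`. -/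
def klE5AB : ℝ := (klIsoPkgB P R Q CU CF).1
/-- **`klE5cB`** — the deferred U-linear constant `c`. -/
def klE5cB : ℝ := (klIsoPkgB P R Q CU CF).2.1
/-- **`klE5dB`** — the deferred quadratic constant `c′`. -/
def klE5dB : ℝ := (klIsoPkgB P R Q CU CF).2.2.1
/-- **`klE5uB`** — the deferred threshold (a DefsU11 `min` term: `klE5uB P R (QT P R) (klCU2 P R (klEngQ7 P R)) CF cc`). -/
def klE5uB : ℝ → ℝ := (klIsoPkgB P R Q CU CF).2.2.2

/-- The deferred package is admissible whenever `0 ≤ CF`. -/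
theorem isIsoPkgB_klIsoPkgB (hCF : 0 ≤ CF) : IsIsoPkgB P CF (klIsoPkgB P R Q CU CF) := by
  classical
  unfold klIsoPkgB
  split_ifs with h
  · exact (Classical.choose_spec h).1
  · exact isIsoPkgB_zero P hCF

/-- `0 ≤ klE5AB` (`0 ≤ CF`). -/
theorem klE5AB_nonneg (hCF : 0 ≤ CF) : 0 ≤ klE5AB P R Q CU CF := (isIsoPkgB_klIsoPkgB P R Q CU CF hCF).1
/-- `0 ≤ klE5cB` (`0 ≤ CF`). -/
theorem klE5cB_nonneg (hCF : 0 ≤ CF) : 0 ≤ klE5cB P R Q CU CF := (isIsoPkgB_klIsoPkgB P R Q CU CF hCF).2.1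
/-- `0 ≤ klE5dB` (`0 ≤ CF`). -/
theorem klE5dB_nonneg (hCF : 0 ≤ CF) : 0 ≤ klE5dB P R Q CU CF := (isIsoPkgB_klIsoPkgB P R Q CU CF hCF).2.2.1
/-- **`0 < klE5uB cc`** (`0 ≤ CF`). -/
theorem klE5uB_pos (hCF : 0 ≤ CF) (cc : ℝ) : 0 < klE5uB P R Q CU CF cc := ((isIsoPkgB_klIsoPkgB P R Q CU CF hCF).2.2.2 cc).1
/-- **The FIT at the threshold**: `klE5AB + 2·(klE5cB + klE5dB·Klam²·(klE5uB cc)) ≤ CF` (`0 ≤ CF`). -/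
theorem klE5B_fit (hCF : 0 ≤ CF) (cc : ℝ) :
    klE5AB P R Q CU CF + 2 * (klE5cB P R Q CU CF + klE5dB P R Q CU CF * P.Klam ^ 2 * klE5uB P R Q CU CF cc) ≤ CF :=
  ((isIsoPkgB_klIsoPkgB P R Q CU CF hCF).2.2.2 cc).2

/-- **The door's fit below the threshold**: `U ≤ klE5uB cc ⟹ klE5AB + 2·(klE5cB + klE5dB·Klam²·U) ≤ CF` (`0 ≤ CF`). -/
theorem klE5B_fit_of_le (hCF : 0 ≤ CF) {cc U : ℝ} (hU : U ≤ klE5uB P R Q CU CF cc) :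
    klE5AB P R Q CU CF + 2 * (klE5cB P R Q CU CF + klE5dB P R Q CU CF * P.Klam ^ 2 * U) ≤ CF := by
  have hd : 0 ≤ klE5dB P R Q CU CF * P.Klam ^ 2 := mul_nonneg (klE5dB_nonneg P R Q CU CF hCF) (sq_nonneg _)
  have h1 := mul_le_mul_of_nonneg_left hU hd
  linarith [klE5B_fit P R Q CU CF hCF cc]

variable {P R Q CU CF}

/-- **The step holds for the deferred package as soon as it holds for some admissible package** (the (X).2 conjunct's consumer). -/
theorem isoTupleLineStepB_klE5B_of_exists
    (h : ∃ e : ℝ × ℝ × ℝ × (ℝ → ℝ), IsIsoPkgB P CF e ∧ IsoTupleLineStepB P R Q CU e.1 e.2.1 e.2.2.1 e.2.2.2) :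
    IsoTupleLineStepB P R Q CU (klE5AB P R Q CU CF) (klE5cB P R Q CU CF) (klE5dB P R Q CU CF) (klE5uB P R Q CU CF) := by
  classical
  have hpkg : klIsoPkgB P R Q CU CF = Classical.choose h := by
    unfold klIsoPkgB
    rw [dif_pos h]
  unfold klE5AB klE5cB klE5dB klE5uB
  rw [hpkg]
  exact (Classical.choose_spec h).2

/-- Packaging an explicit witness. -/
theorem isoTupleLineStepB_klE5B_of {A c c' : ℝ} {u : ℝ → ℝ} (hA : 0 ≤ A) (hc : 0 ≤ c) (hc' : 0 ≤ c')
    (hu : ∀ cc, 0 < u cc ∧ A + 2 * (c + c' * P.Klam ^ 2 * u cc) ≤ CF) (hs : IsoTupleLineStepB P R Q CU A c c' u) :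
    IsoTupleLineStepB P R Q CU (klE5AB P R Q CU CF) (klE5cB P R Q CU CF) (klE5dB P R Q CU CF) (klE5uB P R Q CU CF) :=
  isoTupleLineStepB_klE5B_of_exists ⟨(A, c, c', u), ⟨hA, hc, hc', hu⟩, hs⟩

end Deferred

end Summit.HubbardSuperconductivity.HubbardSuperconductivity.Theorems.KLRegimeSplit

end
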